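import Mathlib
import Literature.Analysis.FluidPDE.PassiveScalarSteadyTest
import Literature.Analysis.FluidPDE.EnergyToolkit
import Summits.AnomalousDissipation.AnomalousDissipation.Theorems.LimitingAbsorptionKinematicSteadySourceLawToolkit
import HarnessLib

/-!
# Ballistic short-lag structure bound of one release (stub B1)

Crux `LimitingAbsorption.FloorUpgrade` (stmt-AnomalousDissipation-15010), line `SketchIdeator1`,
stub `stub_ballistic`: for `κ > 0`, a smooth profile `h` with `‖Δh‖₂ ≤ Dh`, an essentially
bounded drift `u` on `(0,T) × T²` and a weak solution `θ` of `∂ₜθ + u·∇θ = κΔθ`, `θ(0) = h` on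
`[0,T)` (tree notion `Torus.IsWeakScalarTransportOn`),

  `‖h‖² - ⟨h, θ(s)⟩ ≤ 2κ s ‖h‖₂ Dh + 2 (∫₀ˢ ‖u(τ)·∇h‖₂ dτ)²` for a.e. `s ∈ (0,T)`.

Route: test the equation against the steady field `h`
(`IsWeakScalarTransportOn.ae_integral_mul_eq`): `⟨h, θ(s)⟩ = ‖h‖² + ∫_{(0,s]} F` with the flux
`F(τ) = ∫ θ(τ) (⟪u(τ), ∇h⟫ + κΔh)`. Weak incompressibility kills `∫ h ⟪u(τ), ∇h⟫`
(`Torus.integral_mul_inner_gradient_eq_zero`), so by Cauchy–Schwarz and the `L²` contraction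
(`KinematicSteadySourceLaw.ae_scalarL2Sq_le`, which gives `‖θ(τ) - h‖² ≤ 2 D(τ)` with
`D(τ) = -∫_{(0,τ]} F`) one has `|F(τ)| ≤ √(2 D(τ)) ‖u(τ)·∇h‖₂ + κ ‖h‖₂ Dh` for a.e. `τ`
(`Ballistic.abs_flux_le`). With `Φ(s) = ∫_{(0,s]} |F| ≥ D` (monotone in `s`) this integrates to
`Φ(s) ≤ √(2Φ(s)) ∫₀ˢ ‖u·∇h‖₂ + κ ‖h‖₂ Dh s`, whence
`D(s) ≤ Φ(s) ≤ 2 (∫₀ˢ ‖u·∇h‖₂)² + 2κ s ‖h‖₂ Dh` (`Ballistic.neg_setIntegral_le`).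
-/

set_option linter.dupNamespace false

noncomputable section

open MeasureTheory Set Filter Topology
open scoped BigOperators InnerProductSpace

namespace Summit.AnomalousDissipation.AnomalousDissipation.Theorems.FloorUpgradeLine

namespace Ballistic

open Function Literature.Analysis Literature.Analysis.FluidPDE Literature.Analysis.FluidPDE.Torus

section Real

variable {α : Type*} [MeasurableSpace α] {μ : Measure α}

/-- Cauchy–Schwarz with absolute value and monotone majorants for real `L²` functions:
if `∫ f² ≤ A` and `∫ g² ≤ B` then `|∫ f g| ≤ √A √B`. [folklore] -/
theorem abs_integral_mul_le_sqrt_mul_sqrt {f g : α → ℝ} (hf : MemLp f 2 μ) (hg : MemLp g 2 μ)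
    {A B : ℝ} (hA : ∫ x, f x ^ 2 ∂μ ≤ A) (hB : ∫ x, g x ^ 2 ∂μ ≤ B) :
    |∫ x, f x * g x ∂μ| ≤ Real.sqrt A * Real.sqrt B := by
  have hf' : MemLp (fun x => -f x) 2 μ := hf.neg
  have h₁ := integral_mul_le_sqrt_mul_sqrt_of_memLp hf hg
  have h₂ := integral_mul_le_sqrt_mul_sqrt_of_memLp hf' hg
  have e1 : ∫ x, -f x * g x ∂μ = -∫ x, f x * g x ∂μ := by
    rw [← integral_neg]
    exact integral_congr_ae (ae_of_all _ fun x => neg_mul _ _)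
  have e2 : ∫ x, (-f x) ^ 2 ∂μ = ∫ x, f x ^ 2 ∂μ :=
    integral_congr_ae (ae_of_all _ fun x => neg_sq _)
  rw [e1, e2] at h₂
  have hmono : Real.sqrt (∫ x, f x ^ 2 ∂μ) * Real.sqrt (∫ x, g x ^ 2 ∂μ) ≤
      Real.sqrt A * Real.sqrt B :=
    mul_le_mul (Real.sqrt_le_sqrt hA) (Real.sqrt_le_sqrt hB) (Real.sqrt_nonneg _)
      (Real.sqrt_nonneg _)
  rw [abs_le]
  constructor <;> linarith

/-- The quadratic-growth comparison: `Φ ≤ √(2Φ) I + β` with `Φ ≥ 0` forces `Φ ≤ 2 I² + 2 β`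
(`4 I √(2Φ) ≤ 2Φ + 4 I²`). [folklore] -/
theorem le_of_le_sqrt_two_mul {Φ I β : ℝ} (hΦ : 0 ≤ Φ) (h : Φ ≤ Real.sqrt (2 * Φ) * I + β) :
    Φ ≤ 2 * I ^ 2 + 2 * β := by
  have hy : Real.sqrt (2 * Φ) ^ 2 = 2 * Φ := Real.sq_sqrt (by positivity)
  nlinarith [sq_nonneg (Real.sqrt (2 * Φ) - 2 * I), hy]

/-- **The running-bound argument.** If `F` and `a ≥ 0` are integrable on `(0,T)` and
`|F(τ)| ≤ √(2 D(τ)) a(τ) + b` for a.e. `τ ∈ (0,T)`, where `D(τ) = -∫_{(0,τ]} F`, then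
`D(s) ≤ 2 (∫_{(0,s)} a)² + 2 b s` for every `s ∈ (0,T)`: with `Φ(s) = ∫_{(0,s]} |F|` one has
`D ≤ Φ ≤ Φ(s)` on `(0,s]`, so integrating the slice bound gives `Φ(s) ≤ √(2Φ(s)) ∫ a + b s`,
and `le_of_le_sqrt_two_mul` concludes. [folklore] -/
theorem neg_setIntegral_le {T b : ℝ} {F a : ℝ → ℝ} (hF : IntegrableOn F (Ioo 0 T))
    (ha : IntegrableOn a (Ioo 0 T)) (ha0 : ∀ τ, 0 ≤ a τ)
    (hslice : ∀ᵐ τ ∂(volume.restrict (Ioo 0 T)),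
      |F τ| ≤ Real.sqrt (2 * -(∫ r in Ioc 0 τ, F r)) * a τ + b)
    {s : ℝ} (hs : s ∈ Ioo 0 T) :
    -(∫ τ in Ioc 0 s, F τ) ≤ 2 * (∫ τ in Ioo 0 s, a τ) ^ 2 + 2 * (b * s) := by
  have hsub : Ioc 0 s ⊆ Ioo 0 T := Ioc_subset_Ioo_right hs.2
  have hFs : IntegrableOn F (Ioc 0 s) := hF.mono_set hsub
  have hFabs : IntegrableOn (fun τ => |F τ|) (Ioc 0 s) := hFs.abs
  have has : IntegrableOn a (Ioc 0 s) := ha.mono_set hsub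
  set Φ := ∫ τ in Ioc 0 s, |F τ| with hΦ
  have hΦ0 : 0 ≤ Φ := integral_nonneg fun _ => abs_nonneg _
  -- `D ≤ Φ` on `(0, s]`
  have hDΦ : ∀ τ ∈ Ioc 0 s, -(∫ r in Ioc 0 τ, F r) ≤ Φ := by
    intro τ hτ
    calc -(∫ r in Ioc 0 τ, F r) ≤ |∫ r in Ioc 0 τ, F r| := neg_le_abs _
      _ ≤ ∫ r in Ioc 0 τ, |F r| := abs_integral_le_integral_abs
      _ ≤ Φ := setIntegral_mono_set hFabs (ae_of_all _ fun _ => abs_nonneg _)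
          (Ioc_subset_Ioc_right hτ.2).eventuallyLE
  -- integrate the slice bound over `(0, s]`
  have hkey : Φ ≤ Real.sqrt (2 * Φ) * (∫ τ in Ioo 0 s, a τ) + b * s := by
    have hae : ∀ᵐ τ ∂(volume.restrict (Ioc 0 s)), |F τ| ≤ Real.sqrt (2 * Φ) * a τ + b := by
      filter_upwards [ae_restrict_of_ae_restrict_of_subset hsub hslice,
        ae_restrict_mem measurableSet_Ioc] with τ hτ hτm
      have h1 : Real.sqrt (2 * -(∫ r in Ioc 0 τ, F r)) ≤ Real.sqrt (2 * Φ) :=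
        Real.sqrt_le_sqrt (by linarith [hDΦ τ hτm])
      exact hτ.trans (add_le_add (mul_le_mul_of_nonneg_right h1 (ha0 τ)) le_rfl)
    have has' : Integrable (fun τ => Real.sqrt (2 * Φ) * a τ) (volume.restrict (Ioc 0 s)) :=
      has.const_mul _
    have hgi : Integrable (fun τ => Real.sqrt (2 * Φ) * a τ + b) (volume.restrict (Ioc 0 s)) :=
      has'.add (integrable_const _)
    calc Φ ≤ ∫ τ in Ioc 0 s, (Real.sqrt (2 * Φ) * a τ + b) :=
          integral_mono_of_nonneg (ae_of_all _ fun _ => abs_nonneg _) hgi hae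
      _ = Real.sqrt (2 * Φ) * (∫ τ in Ioc 0 s, a τ) + b * s := by
          rw [integral_add has' (integrable_const _), integral_const_mul, setIntegral_const,
            Real.volume_real_Ioc_of_le hs.1.le, sub_zero, smul_eq_mul, mul_comm s b]
      _ = Real.sqrt (2 * Φ) * (∫ τ in Ioo 0 s, a τ) + b * s := by
          rw [integral_Ioc_eq_integral_Ioo]
  calc -(∫ τ in Ioc 0 s, F τ) ≤ Φ := hDΦ s ⟨hs.1, le_rfl⟩
    _ ≤ 2 * (∫ τ in Ioo 0 s, a τ) ^ 2 + 2 * (b * s) := le_of_le_sqrt_two_mul hΦ0 hkey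

end Real

section Torus

variable {d : Type*} [Fintype d]

/-- **Integrability of the pairing norm `τ ↦ ‖u(τ)·G‖_{L²}`** on `(0,T)` for a jointly
measurable drift with `‖u‖ ≤ C` a.e. and a continuous field `G`: it is a.e.-measurable
(Fubini) and bounded by `C sup ‖G‖`. [folklore] -/
theorem integrable_pairingNorm {T C : ℝ} {u : ℝ → UnitAddTorus d → EuclideanSpace ℝ d}
    (hum : AEStronglyMeasurable (uncurry u) ((volume.restrict (Ioo 0 T)).prod volume))
    (hC : 0 ≤ C) (huC : ∀ᵐ t ∂(volume.restrict (Ioo 0 T)), ∀ᵐ x ∂volume, ‖u t x‖ ≤ C)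
    {G : UnitAddTorus d → EuclideanSpace ℝ d} (hG : Continuous G) :
    Integrable (fun τ => Real.sqrt (∫ x, ⟪u τ x, G x⟫_ℝ ^ 2)) (volume.restrict (Ioo 0 T)) := by
  obtain ⟨CG, hCG⟩ := FunctionSpaces.Torus.exists_forall_norm_le_of_continuous hG
  have hCC : 0 ≤ C * CG := mul_nonneg hC ((norm_nonneg _).trans (hCG 0))
  have hm : AEStronglyMeasurable (fun p : ℝ × UnitAddTorus d => ⟪u p.1 p.2, G p.2⟫_ℝ ^ 2)
      ((volume.restrict (Ioo 0 T)).prod volume) :=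
    (continuous_pow 2).comp_aestronglyMeasurable
      (hum.inner (hG.comp continuous_snd).aestronglyMeasurable)
  have hm' : AEStronglyMeasurable (fun τ => ∫ x, ⟪u τ x, G x⟫_ℝ ^ 2)
      (volume.restrict (Ioo 0 T)) := hm.integral_prod_right'
  refine Integrable.mono' (integrable_const (C * CG))
    (Real.continuous_sqrt.comp_aestronglyMeasurable hm') ?_
  filter_upwards [huC] with τ hτ
  rw [Real.norm_of_nonneg (Real.sqrt_nonneg _)]
  calc Real.sqrt (∫ x, ⟪u τ x, G x⟫_ℝ ^ 2)
      ≤ Real.sqrt (∫ _x : UnitAddTorus d, (C * CG) ^ 2) := by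
        refine Real.sqrt_le_sqrt (integral_mono_of_nonneg (ae_of_all _ fun x => sq_nonneg _)
          (integrable_const _) ?_)
        filter_upwards [hτ] with x hx
        have h1 : |⟪u τ x, G x⟫_ℝ| ≤ C * CG :=
          (abs_real_inner_le_norm _ _).trans (mul_le_mul hx (hCG x) (norm_nonneg _) hC)
        exact sq_le_sq' (abs_le.1 h1).1 (abs_le.1 h1).2
    _ = C * CG := by
        rw [integral_const, smul_eq_mul, probReal_univ, one_mul, Real.sqrt_sq hCC]

/-- **Slice estimate.** For a smooth profile `h`, a slice `Θ ∈ L²` with `‖Θ‖² ≤ ‖h‖²` and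
`⟨Θ, h⟩ = ‖h‖² - D`, and a weakly divergence-free, essentially bounded drift slice `v`:
`|∫ Θ (⟪v, ∇h⟫ + κΔh)| ≤ √(2D) ‖⟪v, ∇h⟫‖₂ + κ ‖h‖₂ Dh` whenever `‖Δh‖₂² ≤ Dh²`
(`∫ h ⟪v, ∇h⟫ = 0` by weak incompressibility, Cauchy–Schwarz, and
`‖Θ - h‖² = ‖Θ‖² - 2⟨Θ, h⟩ + ‖h‖² ≤ 2D`). [folklore] -/
theorem abs_flux_le {h Θ : UnitAddTorus d → ℝ} {v : UnitAddTorus d → EuclideanSpace ℝ d}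
    {κ D Dh C : ℝ} (hh : FunctionSpaces.Torus.IsSmooth h) (hΘ : MemLp Θ 2 volume)
    (hdiv : FunctionSpaces.Torus.IsWeaklyDivFree v) (hv : AEStronglyMeasurable v volume)
    (hC : 0 ≤ C) (hvC : ∀ᵐ x ∂volume, ‖v x‖ ≤ C) (hκ : 0 ≤ κ) (hDh : 0 ≤ Dh)
    (hLDh : scalarL2Sq (FunctionSpaces.Torus.laplacian h) ≤ Dh ^ 2)
    (hcontr : scalarL2Sq Θ ≤ scalarL2Sq h) (hid : ∫ x, Θ x * h x = scalarL2Sq h - D) :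
    |∫ x, Θ x * (⟪v x, FunctionSpaces.Torus.gradient h x⟫_ℝ +
        κ * FunctionSpaces.Torus.laplacian h x)| ≤
      Real.sqrt (2 * D) * Real.sqrt (∫ x, ⟪v x, FunctionSpaces.Torus.gradient h x⟫_ℝ ^ 2) +
        κ * Real.sqrt (scalarL2Sq h) * Dh := by
  obtain ⟨CG, hCG⟩ :=
    FunctionSpaces.Torus.exists_forall_norm_le_of_continuous hh.gradient.continuous
  -- the bounded pairing `⟪v, ∇h⟫`
  have hwm : AEStronglyMeasurable (fun x => ⟪v x, FunctionSpaces.Torus.gradient h x⟫_ℝ) volume :=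
    hv.inner hh.gradient.continuous.aestronglyMeasurable
  have hwb : ∀ᵐ x ∂volume, ‖⟪v x, FunctionSpaces.Torus.gradient h x⟫_ℝ‖ ≤ C * CG := by
    filter_upwards [hvC] with x hx
    rw [Real.norm_eq_abs]
    exact (abs_real_inner_le_norm _ _).trans (mul_le_mul hx (hCG x) (norm_nonneg _) hC)
  have hw2 : MemLp (fun x => ⟪v x, FunctionSpaces.Torus.gradient h x⟫_ℝ) 2 volume :=
    (memLp_top_of_bound hwm _ hwb).mono_exponent le_top
  have hh2 : MemLp h 2 volume := hh.memLp 2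
  have hL2 : MemLp (FunctionSpaces.Torus.laplacian h) 2 volume := hh.laplacian.memLp 2
  have hΘh : MemLp (fun x => Θ x - h x) 2 volume := hΘ.sub hh2
  have i1 : Integrable (fun x => (Θ x - h x) * ⟪v x, FunctionSpaces.Torus.gradient h x⟫_ℝ)
      volume := hΘh.integrable_mul hw2
  have i2 : Integrable (fun x => h x * ⟪v x, FunctionSpaces.Torus.gradient h x⟫_ℝ) volume :=
    hh2.integrable_mul hw2
  have i12 : Integrable (fun x => (Θ x - h x) * ⟪v x, FunctionSpaces.Torus.gradient h x⟫_ℝ +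
      h x * ⟪v x, FunctionSpaces.Torus.gradient h x⟫_ℝ) volume := i1.add i2
  have i3 : Integrable (fun x => Θ x * FunctionSpaces.Torus.laplacian h x) volume :=
    hΘ.integrable_mul hL2
  have i3' : Integrable (fun x => κ * (Θ x * FunctionSpaces.Torus.laplacian h x)) volume :=
    i3.const_mul κ
  -- split off the transport term against `h` itself, which vanishes
  have hsplit : ∫ x, Θ x * (⟪v x, FunctionSpaces.Torus.gradient h x⟫_ℝ +
        κ * FunctionSpaces.Torus.laplacian h x) =
      (∫ x, (Θ x - h x) * ⟪v x, FunctionSpaces.Torus.gradient h x⟫_ℝ) +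
        κ * ∫ x, Θ x * FunctionSpaces.Torus.laplacian h x := by
    have e : ∀ x, Θ x * (⟪v x, FunctionSpaces.Torus.gradient h x⟫_ℝ +
          κ * FunctionSpaces.Torus.laplacian h x) =
        ((Θ x - h x) * ⟪v x, FunctionSpaces.Torus.gradient h x⟫_ℝ +
            h x * ⟪v x, FunctionSpaces.Torus.gradient h x⟫_ℝ) +
          κ * (Θ x * FunctionSpaces.Torus.laplacian h x) := fun x => by ring
    simp_rw [e]
    rw [integral_add i12 i3', integral_add i1 i2, integral_const_mul,
      integral_mul_inner_gradient_eq_zero hh hdiv, add_zero]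
  -- `‖Θ - h‖² ≤ 2 D` and Cauchy–Schwarz
  have hexp : ∫ x, (Θ x - h x) ^ 2 =
      (∫ x, Θ x ^ 2) - 2 * (∫ x, Θ x * h x) + ∫ x, h x ^ 2 := by
    have iΘ2 : Integrable (fun x => Θ x ^ 2) volume := hΘ.integrable_sq
    have ihh : Integrable (fun x => h x ^ 2) volume := hh2.integrable_sq
    have iΘh : Integrable (fun x => 2 * (Θ x * h x)) volume := (hΘ.integrable_mul hh2).const_mul 2
    have i12' : Integrable (fun x => Θ x ^ 2 - 2 * (Θ x * h x)) volume := iΘ2.sub iΘh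
    have e : ∀ x, (Θ x - h x) ^ 2 = (Θ x ^ 2 - 2 * (Θ x * h x)) + h x ^ 2 := fun x => by ring
    simp_rw [e]
    rw [integral_add i12' ihh, integral_sub iΘ2 iΘh, integral_const_mul]
  have hΘ2 : scalarL2Sq Θ = ∫ x, Θ x ^ 2 := rfl
  have hh2' : scalarL2Sq h = ∫ x, h x ^ 2 := rfl
  have hdev : ∫ x, (Θ x - h x) ^ 2 ≤ 2 * D := by
    rw [hexp, hid]
    linarith
  have hcontr' : ∫ x, Θ x ^ 2 ≤ scalarL2Sq h := hcontr
  have hLDh' : ∫ x, FunctionSpaces.Torus.laplacian h x ^ 2 ≤ Dh ^ 2 := hLDh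
  have hcs1 := abs_integral_mul_le_sqrt_mul_sqrt hΘh hw2 hdev le_rfl
  have hcs2 := abs_integral_mul_le_sqrt_mul_sqrt hΘ hL2 hcontr' hLDh'
  rw [Real.sqrt_sq hDh] at hcs2
  rw [hsplit]
  calc |(∫ x, (Θ x - h x) * ⟪v x, FunctionSpaces.Torus.gradient h x⟫_ℝ) +
          κ * ∫ x, Θ x * FunctionSpaces.Torus.laplacian h x|
      ≤ |∫ x, (Θ x - h x) * ⟪v x, FunctionSpaces.Torus.gradient h x⟫_ℝ| +
          |κ * ∫ x, Θ x * FunctionSpaces.Torus.laplacian h x| := abs_add_le _ _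
    _ = |∫ x, (Θ x - h x) * ⟪v x, FunctionSpaces.Torus.gradient h x⟫_ℝ| +
          κ * |∫ x, Θ x * FunctionSpaces.Torus.laplacian h x| := by
        rw [abs_mul, abs_of_nonneg hκ]
    _ ≤ Real.sqrt (2 * D) * Real.sqrt (∫ x, ⟪v x, FunctionSpaces.Torus.gradient h x⟫_ℝ ^ 2) +
          κ * (Real.sqrt (scalarL2Sq h) * Dh) :=
        add_le_add hcs1 (mul_le_mul_of_nonneg_left hcs2 hκ)
    _ = _ := by ring

end Torus

end Ballistic

open Ballistic Literature.Analysis Literature.Analysis.FluidPDE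
  Literature.Analysis.FluidPDE.Torus in
/-- **B1: ballistic short-lag structure bound of one release.** For `κ > 0`, a smooth profile
`h` with `‖Δh‖₂ ≤ Dh`, an essentially bounded drift `u` on `(0,T) × T²` and a weak solution
`θ` of `∂ₜθ + u·∇θ = κΔθ`, `θ(0) = h` on `[0,T)`:
`‖h‖² - ⟨h, θ(s)⟩ ≤ 2κ s ‖h‖₂ Dh + 2 (∫₀ˢ ‖u(τ)·∇h‖₂ dτ)²` for a.e. `s ∈ (0,T)`
(test the equation against the steady field `h`: `IsWeakScalarTransportOn.ae_integral_mul_eq`;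
`⟨h, u·∇h⟩ = 0` by weak incompressibility; `‖θ(τ) - h‖² ≤ 2(‖h‖² - ⟨h, θ(τ)⟩)` by the `L²`
contraction `KinematicSteadySourceLaw.ae_scalarL2Sq_le`; then the quadratic-growth comparison
`Ballistic.neg_setIntegral_le` for the running bound `∫_{(0,s]} |F|`). [folklore] -/
theorem stub_ballistic (κ T Dh : ℝ) (u : ℝ → UnitAddTorus (Fin 2) → EuclideanSpace ℝ (Fin 2))
    (h : UnitAddTorus (Fin 2) → ℝ) (θ : ℝ → UnitAddTorus (Fin 2) → ℝ) (hκ : 0 < κ)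
    (hh : Literature.Analysis.FunctionSpaces.Torus.IsSmooth h) (hDh : 0 ≤ Dh)
    (hΔ : Literature.Analysis.FluidPDE.Torus.scalarL2Sq
        (Literature.Analysis.FunctionSpaces.Torus.laplacian h) ≤ Dh ^ 2)
    (hu : MemLp (Literature.Analysis.FunctionSpaces.Torus.stLift u) ⊤
        (volume.restrict (Ioo (0 : ℝ) T ×ˢ univ)))
    (hθ : Literature.Analysis.FluidPDE.Torus.IsWeakScalarTransportOn T κ u h θ) :
    ∀ᵐ s ∂(volume.restrict (Ioo (0 : ℝ) T)),
      Literature.Analysis.FluidPDE.Torus.scalarL2Sq h - ∫ x, h x * θ s x ≤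
        2 * κ * s * Real.sqrt (Literature.Analysis.FluidPDE.Torus.scalarL2Sq h) * Dh +
        2 * (∫ τ in Ioo (0 : ℝ) s, Real.sqrt (∫ x,
              (⟪u τ x, Literature.Analysis.FunctionSpaces.Torus.gradient h x⟫_ℝ) ^ 2)) ^ 2 := by
  obtain ⟨Cu, hCu0, hCu⟩ := ae_ae_norm_le_of_memLp_top_stLift hu
  -- integrability of the flux `F` and of the pairing norm `a` on `(0,T)`
  have hFint : IntegrableOn (fun τ => ∫ x, θ τ x *
      (⟪u τ x, FunctionSpaces.Torus.gradient h x⟫_ℝ + κ * FunctionSpaces.Torus.laplacian h x))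
      (Ioo 0 T) :=
    (hθ.integrable_mul_steadyFlux hh).integral_prod_left
  have haint : IntegrableOn
      (fun τ => Real.sqrt (∫ x, ⟪u τ x, FunctionSpaces.Torus.gradient h x⟫_ℝ ^ 2)) (Ioo 0 T) :=
    integrable_pairingNorm hθ.aestronglyMeasurable_uncurry_velocity hCu0 hCu
      hh.gradient.continuous
  -- the equation tested against the steady field `h`
  have hNhh : ∫ x, h x * h x = scalarL2Sq h := by
    show ∫ x, h x * h x = ∫ x, h x ^ 2
    exact integral_congr_ae (ae_of_all _ fun x => (sq (h x)).symm)
  have hsteady : ∀ᵐ t ∂(volume.restrict (Ioo 0 T)), ∫ x, θ t x * h x =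
      scalarL2Sq h + ∫ τ in Ioc 0 t, ∫ x, θ τ x *
        (⟪u τ x, FunctionSpaces.Torus.gradient h x⟫_ℝ +
          κ * FunctionSpaces.Torus.laplacian h x) := by
    filter_upwards [hθ.ae_integral_mul_eq hh] with t ht
    rw [ht, hNhh]
  -- the a.e. slice bound
  have hslice : ∀ᵐ τ ∂(volume.restrict (Ioo 0 T)),
      |∫ x, θ τ x * (⟪u τ x, FunctionSpaces.Torus.gradient h x⟫_ℝ +
          κ * FunctionSpaces.Torus.laplacian h x)| ≤
        Real.sqrt (2 * -(∫ r in Ioc 0 τ, ∫ x, θ r x *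
            (⟪u r x, FunctionSpaces.Torus.gradient h x⟫_ℝ +
              κ * FunctionSpaces.Torus.laplacian h x))) *
          Real.sqrt (∫ x, ⟪u τ x, FunctionSpaces.Torus.gradient h x⟫_ℝ ^ 2) +
        κ * Real.sqrt (scalarL2Sq h) * Dh := by
    filter_upwards [hsteady, hθ.ae_isWeaklyDivFree, hθ.ae_memLp_two,
      KinematicSteadySourceLaw.ae_scalarL2Sq_le hκ hθ (hh.memLp 2) hu, hCu,
      hθ.ae_aestronglyMeasurable_velocity_slice] with τ hst hdiv hm hcontr hub hvm
    exact abs_flux_le hh hm hdiv hvm hCu0 hub hκ.le hDh hΔ hcontr (by rw [hst]; ring)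
  -- conclusion at every `s` where the steady test holds
  filter_upwards [hsteady, ae_restrict_mem measurableSet_Ioo] with s hs hsT
  have key := neg_setIntegral_le hFint haint (fun τ => Real.sqrt_nonneg _) hslice hsT
  have hcomm : ∫ x, h x * θ s x = ∫ x, θ s x * h x :=
    integral_congr_ae (ae_of_all _ fun x => mul_comm _ _)
  rw [hcomm, hs]
  linarith

end Summit.AnomalousDissipation.AnomalousDissipation.Theorems.FloorUpgradeLine

end
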